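import Summits.BirchSwinnertonDyer.BirchSwinnertonDyer.Theorems.SchneiderFreeAdditiveX3GordTwoBranchIMCReceptacle
import Literature.NumberTheory.EllipticCurves.ModularDegreeQuadraticTwistProofs
import HarnessLib

/-!
# Route `SchneiderFreeAdditiveX3`, crux `GordTwoBranchIMC` (item stmt-BirchSwinnertonDyer-19177):
# the Castella-normalised interpolation value at an ADDITIVE prime has Euler factor `1`

Cell `bsd-schneider-ideate`, seat `bsd-schneider-door-c3` (prover). Companion of the receptacle file
`SchneiderFreeAdditiveX3GordTwoBranchIMCReceptacle.lean` (its finding (F3)). HONEST FRAMING: unfolding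
only; NOTHING is asserted about the existence of a `p`-adic `L`-function at `p² ∣ N`.

At a prime `p` of additive reduction, `p ∣ N_E` (indeed `p² ∣ N_E`) and `a_p(f_E) = a_p(E) = 0`, so in
Castella's interpolation value `bdpInterpolationValue p f 𝔭 φ n Ω_K` (Literature
`BDPAnticyclotomicPAdicLFunction.lean`, Castella 2018 Thm. 3.1: `ε_p = p⁻¹` if `p ∤ N` else `0`) both
`ε_p` and `a_p` vanish and the factor `(1 − a_p p⁻¹ φ(𝔭) + ε_p φ(𝔭)²)²` is `1`
(`bdpInterpolationValue_eq_of_isNewformOf_of_addv`). Hence the tree predicate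
`IsBDPLFunction ι' 𝔭 κ γ f_E Ω_K Ω_p L` at an additive `p` demands EXACTLY
`L(φ̂(γ) − 1) = ι'⁻¹(Γ(n)Γ(n+1)·L(f_E/K, φ, 1)/(π^{2n+1} Ω_K^{4n}))·Ω_p^{4n}`
(`IsBDPLFunction.hasValueAt_of_addv`) — no Euler-type, conductor or Gauss-sum factor. Whether
Keller–Yin's `𝓛_ε = 𝓛_p(f̃)(χ_ε) ∈ Λ^{ur}` (arXiv:2410.23241 §3.4, "`𝓛_p(f̃, χ_ε(·)) = 𝓛_p(f, ·)`")
satisfies THIS normalisation is the un-printed "interpolation matching" step of the route at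
`p² ∣ N`; this file does not assert it, and the receptacle of the crux is kept normalisation-agnostic
for that reason.

References: Castella, Camb. J. Math. 6 (2018) Thm. 3.1 (arXiv:1704.06608 p. 9); Silverman AEC VII.5
Prop. 5.1, App. C §16 (`a_p = 0` at additive `p`); Keller–Yin arXiv:2410.23241 §3.4 (p. 19).
-/

noncomputable section

open scoped Classical

open WeierstrassCurve NumberField IsDedekindDomain Field
  Literature.NumberTheory.EllipticCurves
  Literature.NumberTheory.EllipticCurves.ModularForms
  Literature.NumberTheory.EllipticCurves.Rank1Residual
  Literature.NumberTheory.GaloisRepresentations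

-- D-0017 layout: summit = sub-problem, so `Summit.BirchSwinnertonDyer.BirchSwinnertonDyer.…` is the
-- mandated namespace (same option as the route's sockets files).
set_option linter.dupNamespace false

namespace Summit.BirchSwinnertonDyer.BirchSwinnertonDyer.Theorems.SchneiderFree

section AdditivePrime

variable {W : WeierstrassCurve ℚ} [W.IsElliptic] {p : ℕ} [Fact p.Prime] {N : ℕ} [NeZero N]
  {f : CuspForm (CongruenceSubgroup.Gamma0 N) 2}

/-- **`a_p(f_E) = 0` at an additive prime** for the newform `f_E` of `E` (any level `N` carrying it):
`a_p(f) = a_p(E)` (`IsNewformOf`) and `a_p(E) = 0` when the reduction at `p` is neither good nor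
multiplicative (`WeierstrassCurve.LFunction_apply_eq_zero_of_not_good_of_not_mult`).
[cite: SilvermanAEC2009, VII.5 Prop. 5.1 and App. C §16] -/
theorem cuspCoeff_eq_zero_of_isNewformOf_of_addv (hf : IsNewformOf W f) (hadd : Addv W p) :
    cuspCoeff f p = 0 := by
  rw [hf.2 p, W.LFunction_apply_eq_zero_of_not_good_of_not_mult p hadd.1 hadd.2 (dvd_refl p)]
  simp

/-- **`p ∣ N_E` at an additive prime** (bad reduction; `dvd_conductorNorm_iff_not_hasGoodReductionAtPrime`).
[cite: Silverman1994, IV.10.2] -/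
theorem dvd_conductorNorm_of_addv (hadd : Addv W p) : p ∣ W.conductorNorm ℤ :=
  (W.dvd_conductorNorm_iff_not_hasGoodReductionAtPrime p).mpr hadd.1

/-- **Castella's interpolation value at an additive prime is Euler-factor-free.** For the newform `f`
of `E` at level `N = N_E` and a prime `p` of additive reduction:
`bdpInterpolationValue p f 𝔭 φ n Ω_K = Γ(n)Γ(n+1)·L(f/K, φ, 1)/(π^{2n+1}·Ω_K^{4n})` for every `𝔭`, every
Hecke character `φ` and every `n` (`ε_p = 0` since `p ∣ N`, `a_p(f) = 0`). So the socket's "Euler shift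
`0`" is what the Literature predicate `IsBDPLFunction` itself prescribes at `p² ∣ N`.
[cite: Castella2018, Thm. 3.1 (arXiv:1704.06608 p. 9) (the interpolation formula, read at p ∣ N with a_p = 0)] -/
theorem bdpInterpolationValue_eq_of_isNewformOf_of_addv (hf : IsNewformOf W f)
    (hN : W.conductorNorm ℤ = N) (hadd : Addv W p) {K : Type} [Field K] [NumberField K]
    (𝔭 : HeightOneSpectrum (𝓞 K)) (φ : HeckeCharacter K) (n : ℕ) (ΩK : ℂ) :
    bdpInterpolationValue p f 𝔭 φ n ΩK =
      Complex.Gamma n * Complex.Gamma (n + 1) * rankinSelbergValueHecke f φ 1 /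
        ((Real.pi : ℂ) ^ (2 * n + 1) * ΩK ^ (4 * n)) := by
  have hpN : p ∣ N := hN ▸ dvd_conductorNorm_of_addv (W := W) hadd
  rw [bdpInterpolationValue_of_dvd hpN, cuspCoeff_eq_zero_of_isNewformOf_of_addv hf hadd]
  simp

/-- **What `IsBDPLFunction` prescribes at an additive prime.** If `L ∈ R₀⟦T⟧` satisfies Castella's
interpolation predicate for the newform of `E` (level `N_E`) at a prime `p` of additive reduction,
then at every unramified `φ` of infinity type `(−n, n)`, `n > 0`, with `p`-adic avatar `r` factoring
through `Γ`: `L(φ̂(γ) − 1) = ι'⁻¹(Γ(n)Γ(n+1)·L(f/K, φ, 1)/(π^{2n+1} Ω_K^{4n}))·Ω_p^{4n}` — no Euler-type,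
conductor or Gauss-sum factor. (Unfolding only; the EXISTENCE of such an `L` at `p² ∣ N` is not claimed.)
[cite: Castella2018, Thm. 3.1 (arXiv:1704.06608 p. 9)] -/
theorem IsBDPLFunction.hasValueAt_of_addv (hf : IsNewformOf W f) (hN : W.conductorNorm ℤ = N)
    (hadd : Addv W p) {K : Type} [Field K] [NumberField K] {ι' : PadicAlgCl p ≃+* ℂ}
    {𝔭 : HeightOneSpectrum (𝓞 K)} {κ : ZpExtension K p} {γ : Field.absoluteGaloisGroup K} {ΩK : ℂ}
    {Ωp : ℂ_[p]} {L : UnrSeries p} (hL : IsBDPLFunction ι' 𝔭 κ γ f ΩK Ωp L)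
    {φ : HeckeCharacter K} {n : ℕ} (hn : 0 < n)
    (hunr : ∀ v : HeightOneSpectrum (𝓞 K), φ.IsUnramifiedAt v)
    (hinf : φ.HasInfinityType (fun _ ↦ (n : ℤ)) (fun _ ↦ -(n : ℤ)))
    {r : FramedGaloisRep K (PadicAlgCl p) 1}
    (hr : IsPAdicAvatarOf ι' φ r) (hκ : FactorsThroughZp κ r) :
    L.HasValueAt (avatarValueAt r γ - 1)
      (((ι'.symm (Complex.Gamma n * Complex.Gamma (n + 1) * rankinSelbergValueHecke f φ 1 /
          ((Real.pi : ℂ) ^ (2 * n + 1) * ΩK ^ (4 * n))) : PadicAlgCl p) : ℂ_[p]) * Ωp ^ (4 * n)) := by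
  have h := hL.hasValueAt hn hunr hinf hr hκ
  rwa [bdpInterpolationValue_eq_of_isNewformOf_of_addv hf hN hadd] at h

end AdditivePrime

end Summit.BirchSwinnertonDyer.BirchSwinnertonDyer.Theorems.SchneiderFree

end
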